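import Literature.AlgebraicGeometry.HodgeTheory.HodgeClassesBlowupBirationalInvariance
import Literature.AlgebraicGeometry.HilbertScheme.HilbertSchemeOfPoints
import HarnessLib

/-!
# The Hilbert square of a smooth projective surface is a quotient of the blow-up of `S × S` along the diagonal (Beauville 1983 §6 (e)–(f); Fogarty 1968) — NAMED FACT

Layer `Literature/AlgebraicGeometry/HilbertScheme`.

Source READ (held text `paper:doi-10-4310-jdg-1214438181`): A. Beauville, *Variétés kählériennes dont
la première classe de Chern est nulle*, J. Differential Geom. 18 (1983) 755–782, §6 «Les variétés
`S^{[r]}`», p. 766, verbatim: "(e) La paire `(S^{(r)}_*, D_*)` est localement isomorphe à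
`(ℂ^{2r−2} × Q, ℂ^{2r−2} × o)`, où `Q` est un cône sur une conique lisse, de sommet `o`. Le morphisme
`ε : S^{[r]}_* → S^{(r)}_*` s'identifie à l'éclatement de `D_*` dans `S^{(r)}_*`. Dans `S^r_*`, la
diagonale `Δ_*` est lisse de codimension `2`. Notons `η : B_Δ(S^r_*) → S^r_*` l'éclatement de `Δ_*`;
l'action de `𝔖_r` sur `S^r_*` se prolonge à `B_Δ(S^r_*)`. On déduit facilement de (e) le résultat
suivant. (f) `S^{[r]}_*` s'identifie au quotient de `B_Δ(S^r_*)` par `𝔖_r`. On a donc un diagramme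
commutatif [`ρ : B_Δ(S^r_*) → S^{[r]}_*`, `η`, `ε`, `π`]" — and for `r = 2` the starred open parts are
everything (`D_* = D`: the only diagonal stratum of `S^{(2)}` is `{2x}`), so **`S^{[2]} = B_Δ(S × S)/𝔖₂`
and the quotient map `ρ : B_Δ(S × S) → S^{[2]}` is a finite surjective morphism of degree `2`**
(the classical description of the Hilbert square; algebraicity, smoothness and projectivity of
`S^{[2]} = Hilb²(S)` for a smooth projective surface: Fogarty 1968, Thm. 2.4; `ρ` classifies the
flat degree-`2` family over `B_Δ(S × S)` cut out by the two strict-transformed graphs).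

Rendering (tree carriers): for `S` smooth projective of dimension `2` over `ℂ`
(`Motives.IsSmoothProjective 2 S`) and ANY Hilbert square `(H, Ξ)` of `S`
(`HilbertScheme.IsHilbertSchemeOfPoints 2 S H Ξ` — the representing pair, unique up to unique
isomorphism, `IsHilbertSchemeOfPoints.exists_iso`), there are a SMOOTH BLOW-UP `b : B → S ⊗ S` of
`S × S` along the diagonal `Δ = (𝟙, 𝟙) : S ⟶ S ⊗ S` in the sense of the tree's
`HodgeTheory.IsSmoothBlowupAlong 4 2 (S ⊗ S) S B Δ b` (base, centre and top smooth projective of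
dimensions `4, 2, 4`; `Δ` a closed immersion; `b` the blowing up of the ideal of `Δ(S)`) and a
SURJECTIVE `ℂ`-morphism `ρ : B ⟶ H` (Mathlib's `AlgebraicGeometry.Surjective`).  This is the shape
consumed by the tree's descent of the Hodge conjecture along towers of smooth blow-ups followed by a
surjection (`HodgeTheory.hodgeConjectureFor_of_tower_surjective_le_five`, `SmoothBlowupHodgeConjecture`).

What is NOT here (weaker than print, not stronger): that `ρ` is the quotient by the involution
exchanging the factors (finite of degree `2`, ramified exactly along the exceptional divisor); the
commutative square with the Hilbert–Chow morphism `ε : S^{[2]} → S^{(2)}`; `r ≥ 3` (where only the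
open parts `S^{[r]}_*` are so described); any proof.

## References

* [Beauville1983] A. Beauville, Variétés kählériennes dont la première classe de Chern est nulle,
  J. Differential Geom. 18 (1983) 755–782, §6 (a)–(f), p. 766.
* [Fogarty1968] J. Fogarty, Algebraic families on an algebraic surface, Amer. J. Math. 90 (1968)
  511–521, Thm. 2.4 (smoothness and irreducibility of `Hilbⁿ(S)`).
-/

noncomputable section

open CategoryTheory MonoidalCategory AlgebraicGeometry

namespace Literature.AlgebraicGeometry.HilbertScheme

/-- **Beauville 1983 §6 (e)–(f) at `r = 2` (Fogarty 1968): the Hilbert square `S^{[2]}` of a smooth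
projective complex surface `S` is the quotient of the blow-up `B_Δ(S × S)` of `S × S` along the
diagonal by the involution exchanging the factors; in particular the quotient map
`ρ : B_Δ(S × S) → S^{[2]}` is a surjective morphism.**  Verbatim (p. 766): "Notons
`η : B_Δ(S^r_*) → S^r_*` l'éclatement de `Δ_*` […] (f) `S^{[r]}_*` s'identifie au quotient de
`B_Δ(S^r_*)` par `𝔖_r`" (for `r = 2`, `S^{[2]}_* = S^{[2]}`).  Rendering: for `S` smooth projective of
dimension `2` over `ℂ` and every Hilbert square `(H, Ξ)` of `S` (`IsHilbertSchemeOfPoints 2 S H Ξ`)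
there exist a smooth blow-up `b : B ⟶ S ⊗ S` along the diagonal `(𝟙, 𝟙) : S ⟶ S ⊗ S`
(`HodgeTheory.IsSmoothBlowupAlong 4 2 (S ⊗ S) S B Δ b`) and a surjective `ℂ`-morphism `ρ : B ⟶ H`.
Weaker than print (degree `2`, the quotient structure and the Hilbert–Chow square are not recorded).
A THEOREM in print (status: proved; unproved in the tree); users take `(h : …)`.
[cite: Beauville1983, §6 (e)–(f), p. 766] [cite: Fogarty1968, Thm. 2.4] -/
def Beauville1983_hilbertSquare_blowupDiagonal_surjection : Prop :=
  ∀ (S : Motives.SchemeOver ℂ), Motives.IsSmoothProjective 2 S →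
    ∀ (H : Motives.SchemeOver ℂ) (Ξ : (S ⊗ H).left.IdealSheafData),
      IsHilbertSchemeOfPoints 2 S H Ξ →
        ∃ (B : Motives.SchemeOver ℂ) (b : B ⟶ S ⊗ S) (ρ : B ⟶ H),
          HodgeTheory.IsSmoothBlowupAlong 4 2 (S ⊗ S) S B
              (CartesianMonoidalCategory.lift (𝟙 S) (𝟙 S)) b ∧
            Surjective ρ.left

end Literature.AlgebraicGeometry.HilbertScheme

end
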